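import Mathlib
import Literature.NumberTheory.Transcendental.LindemannWeierstrassProofs
import HarnessLib

/-!
# The Table Maker's Dilemma: breakpoints, bad cases, hardness-to-round bounds, and why they decide correct rounding

Source followed: N. Brisebarre, G. Hanrot, J.-M. Muller, P. Zimmermann, *Correctly Rounded Evaluation of a
Function: Why, How, and at What Cost?*, ACM Computing Surveys 58(1) (2025) [BrisebarreEtAl2025], §2.2
(Definition 2.4: breakpoints), §4.1 (Ziv's strategy: a rounding test "which, when it succeeds, must deliver the
correct rounding"), §4.3 (Problems 4.1/4.2 and Definition 4.3: hardness to round), §4.4 (`m`-bad cases), and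
§4.3.3 ("Regarding the exponential function, we know from Hermite-Lindemann's theorem that the only exact case
is x₀ = [0]"). The same scaled formulation is Problem 1.2 of Brisebarre–Hanrot (arXiv:2606.04858) and the
setting of Lefèvre–Muller, ARITH-15 (2001) [LefevreMuller2001, §1].

## Conventions (as printed, BHMZ §4.3.1 and Problems 4.1/4.2)
Fix a precision `p`, an input binade `[2^e₁, 2^(e₁+1))` and an output binade `[2^e₂, 2^(e₂+1))`. A precision-`p`
floating-point input is `x = X · 2^(e₁-p+1)` with `X ∈ ⟦2^(p-1), 2^p - 1⟧`, and the object studied is the SCALED value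
`g(X) = 2^(p-1-e₂) · f(x)`, for which the precision-`p` numbers of the output binade are the integers
`Y ∈ ⟦2^(p-1), 2^p - 1⟧` and the round-to-nearest midpoints are the half-integers `Y + 1/2`. In these units
"`f(x)` is at distance `< 2^(-m)` ulp-scaled from a breakpoint" reads `|g(X) - Y| < 2^(-m)` (directed) or
`|g(X) - (Y + 1/2)| < 2^(-m)` (to nearest) — BHMZ §4.4: "m-bad cases are floating-points numbers x such that
2^(p−1−e_f(x)) dist(f(x), B•) < 2^−m".

## Contents
* `scaled`, `sigRange`: the scaled value and the significand range (Problems 4.1/4.2).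
* `IsExactCaseDir/RN`, `IsBadCaseDir/RN`: exact cases and `m`-bad cases on the scaled grid (Def. 2.4, §4.4).
* `HardnessToRoundDirLE / HardnessToRoundRNLE f p e₁ e₂ μ`: the property "`μ` solves Problem 4.1 / 4.2",
  i.e. the hardness to round of `f` over the binade is `≤ μ` (Definition 4.3 takes the MINIMUM such `μ`; we
  record the predicate, which is what every published table certifies — e.g. Lefèvre–Muller's Property 1
  for `exp` is `HardnessToRoundDirLE exp 53 e₁ e₂ 113`-type statements binade by binade — and avoid a junk
  `sInf`).
* PROVED (folklore, the reason the TMD matters; BHMZ §4 Fig. 1 and §4.1): if the exact scaled value is not an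
  `m`-bad case and an approximation is within `2^(-m)` of it, then the approximation has the same floor, the
  same ceiling and the same round-to-nearest as the exact value (`floor_eq_floor_of_forall_le_dist`,
  `ceil_eq_ceil_of_forall_le_dist`, `round_eq_round_of_forall_le_dist`, `directedRounding_eq_of_not_isBadCaseDir`,
  `round_eq_of_not_isBadCaseRN`).
* PROVED from the tree's Hermite–Lindemann theorem (`Literature.NumberTheory.Transcendental.transcendental_exp_holds`):
  `exp` has no exact case at any nonzero rational (hence floating-point) argument, for any precision and any
  rounding mode, and `log` has none at any positive rational argument `≠ 1` (BHMZ §4.1/§4.3.3;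
  [LefevreMuller2001, §1 footnote 2]) — the termination hypothesis of Ziv's strategy for these functions;
  and, from the tree's Lindemann–Weierstrass sum form (`LindemannWeierstrass.SumForm_holds`), the same for
  `sin` and `cos` at nonzero rational arguments (BHMZ Table 2; Lefèvre–Ly–Zimmermann 2026, Lemma 2).

What is NOT here: floating-point formats themselves (subnormals, exponent range), Ziv's rounding-test
constant (de Dinechin–Lauter–Muller–Torres 2013), the search algorithms (Lefèvre / SLZ / BH / LLZ) and any
worst-case TABLE — tables are data certified elsewhere; this file only fixes the vocabulary they are stated in.
-/

namespace Literature.ComputerArithmetic.BrisebarreHanrotMullerZimmermann2025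

open Real

/-! ## The scaled setting of Problems 4.1 / 4.2 -/

/-- The significand range `⟦2^(p-1), 2^p - 1⟧` of precision-`p` normal floating-point numbers
(BHMZ §4.3.1: "all input values are elements of … X/2^(p-1-e₁), 2^(p-1) ⩽ X ⩽ 2^p − 1").
[cite: BrisebarreEtAl2025, §4.3.1 and Problem 4.1] -/
def sigRange (p : ℕ) : Set ℤ := Set.Icc (2 ^ (p - 1)) (2 ^ p - 1)

/-- The scaled value `g(X) = 2^(p-1-e₂) · f(X · 2^(e₁-p+1))` of Problems 4.1/4.2: the input is the
precision-`p` number `x = X·2^(e₁-p+1)` of the binade `[2^e₁, 2^(e₁+1))`, and the output is rescaled so that the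
precision-`p` numbers of the output binade `[2^e₂, 2^(e₂+1))` become the integers `⟦2^(p-1), 2^p - 1⟧`.
[cite: BrisebarreEtAl2025, Problem 4.1] -/
noncomputable def scaled (f : ℝ → ℝ) (p : ℕ) (e₁ e₂ : ℤ) (X : ℤ) : ℝ :=
  (2 : ℝ) ^ ((p : ℤ) - 1 - e₂) * f ((X : ℝ) * (2 : ℝ) ^ (e₁ - (p : ℤ) + 1))

/-- `scaled` unfolds as stated. [cite: BrisebarreEtAl2025, Problem 4.1] -/
theorem scaled_def (f : ℝ → ℝ) (p : ℕ) (e₁ e₂ X : ℤ) :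
    scaled f p e₁ e₂ X = (2 : ℝ) ^ ((p : ℤ) - 1 - e₂) * f ((X : ℝ) * (2 : ℝ) ^ (e₁ - (p : ℤ) + 1)) := rfl

/-! ## Breakpoints, exact cases, bad cases (Definition 2.4, §4.4) on the scaled grid -/

/-- Exact case for the DIRECTED rounding functions: the scaled value is a breakpoint, i.e. a floating-point
number of the output binade, i.e. an integer ("For the other rounding functions, they [the breakpoints] are the
floating-point numbers themselves", Def. 2.4). [cite: BrisebarreEtAl2025, Definition 2.4] -/
def IsExactCaseDir (y : ℝ) : Prop := ∃ k : ℤ, y = k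

/-- Exact case for ROUND-TO-NEAREST: the scaled value is a midpoint `k + 1/2` ("For round-to-nearest functions,
the rounding breakpoints are the exact middles of consecutive floating-point numbers", Def. 2.4).
[cite: BrisebarreEtAl2025, Definition 2.4] -/
def IsExactCaseRN (y : ℝ) : Prop := ∃ k : ℤ, y = k + 1 / 2

/-- `m`-bad case, directed rounding: the scaled value is within `2^(-m)` of an integer breakpoint
("m-bad cases are floating-points numbers x such that 2^(p−1−e_f(x)) dist(f(x), B•) < 2^−m", §4.4).
[cite: BrisebarreEtAl2025, §4.4] -/
def IsBadCaseDir (m : ℕ) (y : ℝ) : Prop := ∃ k : ℤ, |y - k| < (2 : ℝ) ^ (-(m : ℤ))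

/-- `m`-bad case, round to nearest: the scaled value is within `2^(-m)` of a midpoint `k + 1/2`.
[cite: BrisebarreEtAl2025, §4.4] -/
def IsBadCaseRN (m : ℕ) (y : ℝ) : Prop := ∃ k : ℤ, |y - (k + 1 / 2)| < (2 : ℝ) ^ (-(m : ℤ))

/-- Not being an `m`-bad case (directed) means being at distance `≥ 2^(-m)` from every integer.
[cite: BrisebarreEtAl2025, §4.4] -/
theorem not_isBadCaseDir_iff (m : ℕ) (y : ℝ) :
    ¬ IsBadCaseDir m y ↔ ∀ k : ℤ, (2 : ℝ) ^ (-(m : ℤ)) ≤ |y - k| := by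
  simp [IsBadCaseDir, not_lt]

/-- Not being an `m`-bad case (to nearest) means being at distance `≥ 2^(-m)` from every midpoint.
[cite: BrisebarreEtAl2025, §4.4] -/
theorem not_isBadCaseRN_iff (m : ℕ) (y : ℝ) :
    ¬ IsBadCaseRN m y ↔ ∀ k : ℤ, (2 : ℝ) ^ (-(m : ℤ)) ≤ |y - (k + 1 / 2)| := by
  simp [IsBadCaseRN, not_lt]

/-- An exact case is an `m`-bad case for every `m` (distance `0 < 2^(-m)`).
[cite: BrisebarreEtAl2025, §4.4] -/
theorem IsExactCaseDir.isBadCaseDir {y : ℝ} (h : IsExactCaseDir y) (m : ℕ) : IsBadCaseDir m y := by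
  obtain ⟨k, rfl⟩ := h
  exact ⟨k, by simp⟩

/-- An exact case for round-to-nearest is an `m`-bad case (RN) for every `m`.
[cite: BrisebarreEtAl2025, §4.4] -/
theorem IsExactCaseRN.isBadCaseRN {y : ℝ} (h : IsExactCaseRN y) (m : ℕ) : IsBadCaseRN m y := by
  obtain ⟨k, rfl⟩ := h
  exact ⟨k, by simp⟩

/-! ## Hardness to round (Problems 4.1 / 4.2, Definition 4.3) as a certified BOUND -/

/-- **Problem 4.1 (TMD, directed rounding functions)**, as the property of a candidate answer `μ`:
for every significand `X ∈ ⟦2^(p-1), 2^p-1⟧` whose scaled image `g(X)` is not an exact (integer) case, and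
every `Y ∈ ⟦2^(p-1), 2^p⟧`, `|g(X) - Y| ≥ 2^(-μ)`. The hardness to round of `f` on the binade for directed
rounding (Definition 4.3) is the least such `μ`; a published worst-case table for a binade certifies exactly a
statement of this shape. [cite: BrisebarreEtAl2025, Problem 4.1 and Definition 4.3] -/
def HardnessToRoundDirLE (f : ℝ → ℝ) (p : ℕ) (e₁ e₂ : ℤ) (μ : ℤ) : Prop :=
  ∀ X ∈ sigRange p, ¬ IsExactCaseDir (scaled f p e₁ e₂ X) →
    ∀ Y : ℤ, Y ∈ Set.Icc (2 ^ (p - 1)) (2 ^ p) → (2 : ℝ) ^ (-μ) ≤ |scaled f p e₁ e₂ X - Y|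

/-- **Problem 4.2 (TMD, rounding to nearest functions)**, as the property of a candidate answer `μ`:
for every significand `X ∈ ⟦2^(p-1), 2^p-1⟧` whose scaled image is not a midpoint, and every
`Y ∈ ⟦2^(p-1), 2^p - 1⟧`, `|g(X) - (Y + 1/2)| ≥ 2^(-μ)`. [cite: BrisebarreEtAl2025, Problem 4.2 and Definition 4.3] -/
def HardnessToRoundRNLE (f : ℝ → ℝ) (p : ℕ) (e₁ e₂ : ℤ) (μ : ℤ) : Prop :=
  ∀ X ∈ sigRange p, ¬ IsExactCaseRN (scaled f p e₁ e₂ X) →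
    ∀ Y : ℤ, Y ∈ Set.Icc (2 ^ (p - 1)) (2 ^ p - 1) → (2 : ℝ) ^ (-μ) ≤ |scaled f p e₁ e₂ X - (Y + 1 / 2)|

/-- The bound is monotone: a larger `μ` is a weaker statement (Definition 4.3 takes the minimum).
[cite: BrisebarreEtAl2025, Definition 4.3] -/
theorem HardnessToRoundDirLE.mono {f : ℝ → ℝ} {p : ℕ} {e₁ e₂ μ μ' : ℤ}
    (h : HardnessToRoundDirLE f p e₁ e₂ μ) (hμ : μ ≤ μ') : HardnessToRoundDirLE f p e₁ e₂ μ' := by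
  intro X hX hne Y hY
  exact le_trans (zpow_le_zpow_right₀ (by norm_num) (neg_le_neg hμ)) (h X hX hne Y hY)

/-- Monotonicity of the round-to-nearest bound in `μ`. [cite: BrisebarreEtAl2025, Definition 4.3] -/
theorem HardnessToRoundRNLE.mono {f : ℝ → ℝ} {p : ℕ} {e₁ e₂ μ μ' : ℤ}
    (h : HardnessToRoundRNLE f p e₁ e₂ μ) (hμ : μ ≤ μ') : HardnessToRoundRNLE f p e₁ e₂ μ' := by
  intro X hX hne Y hY
  exact le_trans (zpow_le_zpow_right₀ (by norm_num) (neg_le_neg hμ)) (h X hX hne Y hY)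

/-! ## Why it matters: an approximation within the hardness bound rounds like the exact value
(the "green interval" of BHMZ Fig. 1; the soundness requirement on Ziv's rounding test, §4.1) -/

/-- If `y` is at distance at least `δ` from every integer and `y'` is within `δ` of `y`, then `⌊y'⌋ = ⌊y⌋`:
rounding the approximation downwards gives the downward rounding of the exact value.
[cite: BrisebarreEtAl2025, §4 (Fig. 1) and §4.1] -/
theorem floor_eq_floor_of_forall_le_dist {y y' δ : ℝ}
    (hδ : ∀ k : ℤ, δ ≤ |y - k|) (h : |y' - y| < δ) : ⌊y'⌋ = ⌊y⌋ := by
  have h1 : ((⌊y⌋ : ℤ) : ℝ) ≤ y := Int.floor_le y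
  have h2 : y < ((⌊y⌋ : ℤ) : ℝ) + 1 := Int.lt_floor_add_one y
  obtain ⟨hl, hr⟩ := abs_lt.mp h
  rw [Int.floor_eq_iff]
  constructor
  · have hk := hδ ⌊y⌋
    rw [abs_of_nonneg (by linarith)] at hk
    linarith
  · have hk := hδ (⌊y⌋ + 1)
    push_cast at hk
    rw [abs_of_nonpos (by linarith)] at hk
    linarith

/-- If `y` is at distance at least `δ` from every integer and `y'` is within `δ` of `y`, then `⌈y'⌉ = ⌈y⌉`
(upward rounding). [cite: BrisebarreEtAl2025, §4 (Fig. 1) and §4.1] -/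
theorem ceil_eq_ceil_of_forall_le_dist {y y' δ : ℝ}
    (hδ : ∀ k : ℤ, δ ≤ |y - k|) (h : |y' - y| < δ) : ⌈y'⌉ = ⌈y⌉ := by
  have h1 : ((⌈y⌉ : ℤ) : ℝ) - 1 < y := by linarith [Int.ceil_lt_add_one y]
  have h2 : y ≤ ((⌈y⌉ : ℤ) : ℝ) := Int.le_ceil y
  obtain ⟨hl, hr⟩ := abs_lt.mp h
  rw [Int.ceil_eq_iff]
  constructor
  · have hk := hδ (⌈y⌉ - 1)
    push_cast at hk
    rw [abs_of_nonneg (by linarith)] at hk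
    linarith
  · have hk := hδ ⌈y⌉
    rw [abs_of_nonpos (by linarith)] at hk
    linarith

/-- If `y` is at distance at least `δ` from every midpoint `k + 1/2` and `y'` is within `δ` of `y`, then
`round y' = round y` (round to nearest; Mathlib's `round` breaks ties upwards, which is immaterial here since
`y` is not a tie and neither, a fortiori, is `y'`). [cite: BrisebarreEtAl2025, §4 (Fig. 1) and §4.1] -/
theorem round_eq_round_of_forall_le_dist {y y' δ : ℝ}
    (hδ : ∀ k : ℤ, δ ≤ |y - (k + 1 / 2)|) (h : |y' - y| < δ) : round y' = round y := by
  rw [round_eq, round_eq]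
  apply floor_eq_floor_of_forall_le_dist (y := y + 1 / 2)
  · intro k
    have hk := hδ (k - 1)
    push_cast at hk
    have : y - ((k : ℝ) - 1 + 1 / 2) = y + 1 / 2 - k := by ring
    rwa [this] at hk
  · have : y' + 1 / 2 - (y + 1 / 2) = y' - y := by ring
    rwa [this]

/-- **TMD exclusion principle, directed roundings.** If the exact scaled value `y` is not an `m`-bad case
and `y'` approximates it to within `2^(-m)`, then `y'` and `y` have the same floor and the same ceiling, so
every directed rounding (down, up, toward/away from zero) of `y'` is that of `y`.
[cite: BrisebarreEtAl2025, §4.1 and §4.4] -/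
theorem directedRounding_eq_of_not_isBadCaseDir {m : ℕ} {y y' : ℝ}
    (hy : ¬ IsBadCaseDir m y) (h : |y' - y| < (2 : ℝ) ^ (-(m : ℤ))) : ⌊y'⌋ = ⌊y⌋ ∧ ⌈y'⌉ = ⌈y⌉ :=
  ⟨floor_eq_floor_of_forall_le_dist ((not_isBadCaseDir_iff m y).mp hy) h,
   ceil_eq_ceil_of_forall_le_dist ((not_isBadCaseDir_iff m y).mp hy) h⟩

/-- **TMD exclusion principle, round to nearest.** If the exact scaled value `y` is not an `m`-bad case for
round-to-nearest and `y'` approximates it to within `2^(-m)`, then `round y' = round y`.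
[cite: BrisebarreEtAl2025, §4.1 and §4.4] -/
theorem round_eq_of_not_isBadCaseRN {m : ℕ} {y y' : ℝ}
    (hy : ¬ IsBadCaseRN m y) (h : |y' - y| < (2 : ℝ) ^ (-(m : ℤ))) : round y' = round y :=
  round_eq_round_of_forall_le_dist ((not_isBadCaseRN_iff m y).mp hy) h

/-- Binade form: if `μ` solves Problem 4.1 for `f` on the binade and `X` is a non-exact significand, then any
approximation of the scaled value `g(X)` to within `2^(-μ)` that stays in the closed output binade has the same
floor and ceiling as `g(X)` — provided `g(X)` itself lies in the output binade `[2^(p-1), 2^p]` so that the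
nearest integers are among the `Y` quantified over. [cite: BrisebarreEtAl2025, Problem 4.1 and §4.1] -/
theorem HardnessToRoundDirLE.floor_eq_and_ceil_eq {f : ℝ → ℝ} {p : ℕ} {e₁ e₂ μ : ℤ}
    (hμ : HardnessToRoundDirLE f p e₁ e₂ μ) {X : ℤ} (hX : X ∈ sigRange p)
    (hne : ¬ IsExactCaseDir (scaled f p e₁ e₂ X))
    (hrange : (2 : ℝ) ^ (p - 1) ≤ scaled f p e₁ e₂ X ∧ scaled f p e₁ e₂ X ≤ (2 : ℝ) ^ p)
    {y' : ℝ} (h : |y' - scaled f p e₁ e₂ X| < (2 : ℝ) ^ (-μ)) :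
    ⌊y'⌋ = ⌊scaled f p e₁ e₂ X⌋ ∧ ⌈y'⌉ = ⌈scaled f p e₁ e₂ X⌉ := by
  set y := scaled f p e₁ e₂ X with hy
  have hpos : (0 : ℝ) < (2 : ℝ) ^ (-μ) := zpow_pos (by norm_num) _
  -- distance ≥ 2^-μ from every integer: inside the binade by `hμ`, outside by `hrange`
  have hall : ∀ k : ℤ, (2 : ℝ) ^ (-μ) ≤ |y - k| := by
    intro k
    by_cases hk : k ∈ Set.Icc (2 ^ (p - 1)) (2 ^ p)
    · exact hμ X hX hne k hk
    · -- k is outside the closed binade: |y - k| ≥ min(y - 2^p ... ) handled via the nearest endpoint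
      rw [Set.mem_Icc, not_and_or, not_le, not_le] at hk
      rcases hk with hk | hk
      · -- k < 2^(p-1) so k ≤ 2^(p-1) - 1 and y ≥ 2^(p-1): y - k ≥ 1 ≥ ... no: we only get ≥ y - (2^(p-1)-1).
        -- Use the endpoint 2^(p-1), which IS in the binade and is an integer breakpoint.
        have hend : (2 : ℝ) ^ (-μ) ≤ |y - ((2 : ℤ) ^ (p - 1) : ℤ)| :=
          hμ X hX hne _ ⟨le_rfl, by
            have : (2:ℤ) ^ (p-1) ≤ 2 ^ p := pow_le_pow_right₀ (by norm_num) (Nat.sub_le p 1)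
            exact this⟩
        have hk' : (k : ℝ) ≤ (2 : ℝ) ^ (p - 1) - 1 := by
          have : k ≤ 2 ^ (p - 1) - 1 := by omega
          exact_mod_cast this
        have hyk : (2 : ℝ) ^ (p - 1) ≤ y := hrange.1
        push_cast at hend
        rw [abs_of_nonneg (by linarith)] at hend
        rw [abs_of_nonneg (by linarith)]
        linarith
      · have hend : (2 : ℝ) ^ (-μ) ≤ |y - ((2 : ℤ) ^ p : ℤ)| :=
          hμ X hX hne _ ⟨pow_le_pow_right₀ (by norm_num) (Nat.sub_le p 1), le_rfl⟩
        have hk' : (2 : ℝ) ^ p + 1 ≤ (k : ℝ) := by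
          have : 2 ^ p + 1 ≤ k := by omega
          exact_mod_cast this
        have hyk : y ≤ (2 : ℝ) ^ p := hrange.2
        push_cast at hend
        rw [abs_of_nonpos (by linarith)] at hend
        rw [abs_of_nonpos (by linarith)]
        linarith
  exact ⟨floor_eq_floor_of_forall_le_dist hall h, ceil_eq_ceil_of_forall_le_dist hall h⟩

/-! ## No exact cases for `exp` and `log` at rational arguments (Hermite–Lindemann) -/

/-- Hermite–Lindemann in the form used by the TMD literature: for a nonzero rational `q`, `exp q` is
transcendental (from the tree's `Literature.NumberTheory.Transcendental.transcendental_exp_holds`).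
BHMZ §4.3.3: "Regarding the exponential function, we know from Hermite-Lindemann's theorem [74] that the only
exact case is x₀ = [0]". [cite: BrisebarreEtAl2025, §4.3.3] -/
theorem transcendental_exp_ratCast {q : ℚ} (hq : q ≠ 0) : Transcendental ℚ (Real.exp q) := by
  have halg : IsAlgebraic ℚ ((q : ℝ) : ℂ) := by
    have : ((q : ℝ) : ℂ) = algebraMap ℚ ℂ q := by simp
    rw [this]; exact isAlgebraic_algebraMap q
  have hne : ((q : ℝ) : ℂ) ≠ 0 := by exact_mod_cast hq
  have ht : Transcendental ℚ (Complex.exp ((q : ℝ) : ℂ)) :=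
    Literature.NumberTheory.Transcendental.transcendental_exp_holds halg hne
  rw [← Complex.ofReal_exp, ← Complex.coe_algebraMap] at ht
  -- transfer transcendence from `ℂ` back to `ℝ` along the injective `algebraMap ℝ ℂ`
  exact (transcendental_algebraMap_iff (R := ℚ) (A := ℂ) (a := Real.exp (q : ℝ))
    Complex.ofReal_injective).mp ht

/-- For a nonzero rational `q`, `exp q` is irrational. [cite: BrisebarreEtAl2025, §4.3.3] -/
theorem irrational_exp_ratCast {q : ℚ} (hq : q ≠ 0) : Irrational (Real.exp q) :=
  (transcendental_exp_ratCast hq).irrational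

/-- **`exp` has no exact case at a nonzero rational argument, in any precision and for any rounding mode**:
for rational `c ≠ 0` (the scaling `2^(p-1-e₂)` is such a `c`) and rational `q ≠ 0` (every finite floating-point
number is such a `q`), `c · exp q` is irrational, hence is neither a floating-point number nor a midpoint
(both are rationals). This is the finiteness hypothesis of Ziv's strategy for `exp` (BHMZ §4.1: "requires …
the knowledge that there are no nontrivial exact cases …, which is known to be true for the exponential …
thanks to Hermite-Lindemann's theorem"). [cite: BrisebarreEtAl2025, §4.1 and §4.3.3] -/
theorem irrational_ratCast_mul_exp_ratCast {c q : ℚ} (hc : c ≠ 0) (hq : q ≠ 0) :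
    Irrational ((c : ℝ) * Real.exp q) :=
  (irrational_exp_ratCast hq).ratCast_mul hc

/-- Corollary in the vocabulary of this file: for rational `c ≠ 0`, `q ≠ 0`, the value `c · exp q` is neither a
directed-rounding exact case (an integer) nor a round-to-nearest exact case (a half-integer).
[cite: BrisebarreEtAl2025, §4.3.3] -/
theorem exp_no_exact_case {c q : ℚ} (hc : c ≠ 0) (hq : q ≠ 0) :
    ¬ IsExactCaseDir ((c : ℝ) * Real.exp q) ∧ ¬ IsExactCaseRN ((c : ℝ) * Real.exp q) := by
  have hirr := irrational_ratCast_mul_exp_ratCast hc hq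
  refine ⟨?_, ?_⟩
  · rintro ⟨k, hk⟩
    exact hirr.ne_int k hk
  · rintro ⟨k, hk⟩
    have : ((c : ℝ) * Real.exp q) = ((k + 1 / 2 : ℚ) : ℝ) := by rw [hk]; push_cast; ring
    exact hirr.ne_rat _ this

/-- **`log` has no exact case at a positive rational argument other than `1`**: if `x ∈ ℚ`, `0 < x`, `x ≠ 1`
then `log x` is irrational (so `c · log x` is no breakpoint for rational `c ≠ 0`); Lefèvre–Muller: "1 is the
only input value for which [log has] a finite representation". [cite: LefevreMuller2001, §1 footnote 2] -/
theorem irrational_log_ratCast {x : ℚ} (hx : 0 < x) (hx1 : x ≠ 1) : Irrational (Real.log x) := by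
  rw [irrational_iff_ne_rational]
  intro a b hb hlog
  -- log x = a/b with a/b rational; then exp (a/b) = x is rational, forcing a/b = 0, i.e. x = 1
  have hexp : Real.exp ((a / b : ℚ) : ℝ) = x := by
    have : ((a / b : ℚ) : ℝ) = (a : ℝ) / b := by push_cast; ring
    rw [this, ← hlog, Real.exp_log (by exact_mod_cast hx)]
  by_cases hq : (a / b : ℚ) = 0
  · rw [hq] at hexp
    simp only [Rat.cast_zero, Real.exp_zero] at hexp
    exact hx1 (by exact_mod_cast hexp.symm)
  · exact (irrational_exp_ratCast hq).ne_rat x hexp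

/-- For rational `c ≠ 0` and rational `x > 0`, `x ≠ 1`, the value `c · log x` is irrational, hence no exact case
for any precision or rounding mode. [cite: LefevreMuller2001, §1 footnote 2] -/
theorem log_no_exact_case {c x : ℚ} (hc : c ≠ 0) (hx : 0 < x) (hx1 : x ≠ 1) :
    ¬ IsExactCaseDir ((c : ℝ) * Real.log x) ∧ ¬ IsExactCaseRN ((c : ℝ) * Real.log x) := by
  have hirr := (irrational_log_ratCast hx hx1).ratCast_mul hc
  refine ⟨?_, ?_⟩
  · rintro ⟨k, hk⟩
    exact hirr.ne_int k hk
  · rintro ⟨k, hk⟩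
    have : ((c : ℝ) * Real.log x) = ((k + 1 / 2 : ℚ) : ℝ) := by rw [hk]; push_cast; ring
    exact hirr.ne_rat _ this


/-! ## No exact cases for `sin`, `cos` at nonzero rational arguments (Lindemann–Weierstrass)

BHMZ §4.1 ("known to be true for the exponential, logarithmic and trigonometric functions thanks to
Hermite-Lindemann's theorem") and Table 2 (trigonometric bad cases reduce to exponential ones); this is also
the fact used in Lefèvre–Ly–Zimmermann (ARITH 2026), proof of Lemma 2: "sin x cannot be exact for any
non-zero floating-point number x". Proofs: a putative algebraic value `s` of `sin q` (resp. `c` of `cos q`)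
gives the relation `e^{iq} − e^{−iq} − 2is·e^0 = 0` (resp. `e^{iq} + e^{−iq} − 2c·e^0 = 0`) with distinct
algebraic exponents and algebraic, not all zero, coefficients, contradicting the sum form of the
Lindemann–Weierstrass theorem proved in the tree (`LindemannWeierstrass.SumForm_holds`). -/

section Trig

open Complex Finset Literature.NumberTheory.Transcendental.LindemannWeierstrass

/-- `i` is algebraic (root of `X² + 1`). [folklore] -/
private theorem isAlgebraic_I : IsAlgebraic ℚ Complex.I := by
  refine ⟨Polynomial.X ^ 2 + 1, Polynomial.Monic.ne_zero (by monicity!), ?_⟩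
  simp

/-- The three exponents `0, iq, −iq` are pairwise distinct for `q ≠ 0`. [folklore] -/
private theorem trig_exponents_distinct {q : ℚ} (hq : q ≠ 0) :
    ((q : ℂ) * I ≠ -((q : ℂ) * I)) ∧ (0 : ℂ) ≠ (q : ℂ) * I ∧ (0 : ℂ) ≠ -((q : ℂ) * I) := by
  have hqI : (q : ℂ) * I ≠ 0 := mul_ne_zero (by exact_mod_cast hq) I_ne_zero
  refine ⟨?_, hqI.symm, ?_⟩
  · intro h
    have : (2 : ℂ) * ((q : ℂ) * I) = 0 := by linear_combination h
    exact hqI (by simpa using this)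
  · simpa using hqI.symm

/-- A three-term exponential relation `a₀·e^0 + a₁·e^{iq} + a₂·e^{−iq} = 0` with algebraic coefficients and
`a₁ ≠ 0` is impossible for rational `q ≠ 0` (Lindemann–Weierstrass, sum form, from the tree).
[cite: BrisebarreEtAl2025, §4.1 and Table 2] -/
private theorem no_three_term_relation {q : ℚ} (hq : q ≠ 0) {a₀ a₁ a₂ : ℂ}
    (h₀ : IsAlgebraic ℚ a₀) (h₁ : IsAlgebraic ℚ a₁) (h₂ : IsAlgebraic ℚ a₂) (ha₁ : a₁ ≠ 0) :
    a₀ * cexp 0 + (a₁ * cexp ((q : ℂ) * I) + a₂ * cexp (-((q : ℂ) * I))) ≠ 0 := by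
  obtain ⟨hpm, h0p, h0m⟩ := trig_exponents_distinct hq
  -- coefficients as a function on the finite set of exponents `{0, iq, -iq}`
  let a : ℂ → ℂ := fun x => if x = 0 then a₀ else if x = (q : ℂ) * I then a₁ else a₂
  have ha0 : a 0 = a₀ := by simp [a]
  have ha1 : a ((q : ℂ) * I) = a₁ := by simp [a, h0p.symm]
  have ha2 : a (-((q : ℂ) * I)) = a₂ := by simp [a, h0m.symm, hpm.symm]
  have hsum := SumForm_holds.sum_ne_zero ({0, (q : ℂ) * I, -((q : ℂ) * I)} : Finset ℂ) id a ?_ ?_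
    (Set.injOn_id _) ⟨(q : ℂ) * I, by simp, by rwa [ha1]⟩
  · rwa [sum_insert (by simp [h0p, h0m]), sum_pair hpm, id, id, id, ha0, ha1, ha2] at hsum
  · intro x hx
    simp only [mem_insert, mem_singleton] at hx
    rcases hx with rfl | rfl | rfl
    · exact isAlgebraic_zero
    · exact (isAlgebraic_algebraMap (R := ℚ) (A := ℂ) q).mul isAlgebraic_I
    · exact ((isAlgebraic_algebraMap (R := ℚ) (A := ℂ) q).mul isAlgebraic_I).neg
  · intro x hx
    simp only [a]
    split_ifs
    · exact h₀
    · exact h₁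
    · exact h₂

/-- For a nonzero rational `q`, `sin q` is transcendental. [cite: BrisebarreEtAl2025, §4.1 and Table 2] -/
theorem transcendental_sin_ratCast {q : ℚ} (hq : q ≠ 0) : Transcendental ℚ (Real.sin q) := by
  intro hs
  have hsC : IsAlgebraic ℚ ((Real.sin q : ℝ) : ℂ) :=
    (isAlgebraic_algebraMap_iff (A := ℂ) Complex.ofReal_injective).mpr hs
  set s : ℂ := ((Real.sin q : ℝ) : ℂ) with hs_def
  have hsin : Complex.sin (q : ℂ) = s := by
    simp [hs_def, Complex.ofReal_sin]
  have h2 : IsAlgebraic ℚ (2 : ℂ) := by simpa using isAlgebraic_nat (R := ℚ) (A := ℂ) 2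
  refine no_three_term_relation hq (a₀ := -(2 * I * s)) (a₁ := 1) (a₂ := -1)
    ((h2.mul isAlgebraic_I).mul hsC).neg isAlgebraic_one isAlgebraic_one.neg one_ne_zero ?_
  have e1 : cexp ((q : ℂ) * I) = Complex.cos q + Complex.sin q * I := (Complex.cos_add_sin_I _).symm
  have e2 : cexp (-((q : ℂ) * I)) = Complex.cos q - Complex.sin q * I := by
    rw [show -((q : ℂ) * I) = -(q : ℂ) * I by ring]; exact (Complex.cos_sub_sin_I _).symm
  rw [Complex.exp_zero, e1, e2, hsin]
  ring

/-- For a nonzero rational `q`, `cos q` is transcendental. [cite: BrisebarreEtAl2025, §4.1 and Table 2] -/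
theorem transcendental_cos_ratCast {q : ℚ} (hq : q ≠ 0) : Transcendental ℚ (Real.cos q) := by
  intro hc
  have hcC : IsAlgebraic ℚ ((Real.cos q : ℝ) : ℂ) :=
    (isAlgebraic_algebraMap_iff (A := ℂ) Complex.ofReal_injective).mpr hc
  set c : ℂ := ((Real.cos q : ℝ) : ℂ) with hc_def
  have hcos : Complex.cos (q : ℂ) = c := by
    simp [hc_def, Complex.ofReal_cos]
  have h2 : IsAlgebraic ℚ (2 : ℂ) := by simpa using isAlgebraic_nat (R := ℚ) (A := ℂ) 2
  refine no_three_term_relation hq (a₀ := -(2 * c)) (a₁ := 1) (a₂ := 1)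
    (h2.mul hcC).neg isAlgebraic_one isAlgebraic_one one_ne_zero ?_
  have e1 : cexp ((q : ℂ) * I) = Complex.cos q + Complex.sin q * I := (Complex.cos_add_sin_I _).symm
  have e2 : cexp (-((q : ℂ) * I)) = Complex.cos q - Complex.sin q * I := by
    rw [show -((q : ℂ) * I) = -(q : ℂ) * I by ring]; exact (Complex.cos_sub_sin_I _).symm
  rw [Complex.exp_zero, e1, e2, hcos]
  ring

/-- **`sin` has no exact case at a nonzero rational argument** (any precision, any rounding mode): for
rational `c ≠ 0` and `q ≠ 0`, `c · sin q` is irrational, hence neither an integer (directed breakpoint) nor a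
half-integer (midpoint) of the scaled grid — the fact invoked in Lefèvre–Ly–Zimmermann 2026, Lemma 2 ("sin x
cannot be exact for any non-zero floating-point number x"). [cite: BrisebarreEtAl2025, §4.1 and Table 2] -/
theorem sin_no_exact_case {c q : ℚ} (hc : c ≠ 0) (hq : q ≠ 0) :
    ¬ IsExactCaseDir ((c : ℝ) * Real.sin q) ∧ ¬ IsExactCaseRN ((c : ℝ) * Real.sin q) := by
  have hirr := ((transcendental_sin_ratCast hq).irrational).ratCast_mul hc
  refine ⟨?_, ?_⟩
  · rintro ⟨k, hk⟩
    exact hirr.ne_int k hk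
  · rintro ⟨k, hk⟩
    have : ((c : ℝ) * Real.sin q) = ((k + 1 / 2 : ℚ) : ℝ) := by rw [hk]; push_cast; ring
    exact hirr.ne_rat _ this

/-- **`cos` has no exact case at a nonzero rational argument** (any precision, any rounding mode).
[cite: BrisebarreEtAl2025, §4.1 and Table 2] -/
theorem cos_no_exact_case {c q : ℚ} (hc : c ≠ 0) (hq : q ≠ 0) :
    ¬ IsExactCaseDir ((c : ℝ) * Real.cos q) ∧ ¬ IsExactCaseRN ((c : ℝ) * Real.cos q) := by
  have hirr := ((transcendental_cos_ratCast hq).irrational).ratCast_mul hc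
  refine ⟨?_, ?_⟩
  · rintro ⟨k, hk⟩
    exact hirr.ne_int k hk
  · rintro ⟨k, hk⟩
    have : ((c : ℝ) * Real.cos q) = ((k + 1 / 2 : ℚ) : ℝ) := by rw [hk]; push_cast; ring
    exact hirr.ne_rat _ this

end Trig


/-! ## APPEND (lit gen-6, 2026-08-20): sign symmetry of the breakpoint sets, and Lemma 4.8 (bad cases of a
function vs. bad cases of its inverse)

The breakpoint sets of Definition 2.4 — the integers (directed roundings) and the half-integers (round to
nearest) of the scaled grid — are symmetric under `y ↦ −y`; hence exactness and `m`-badness of a scaled value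
only depend on its absolute value. This is the fact behind listing ONE token for the two arguments `±x` of an
odd or even function (CORE-MATH `WORST_SYMMETRIC`, `check_worst_uni.c`): for odd `f` the scaled value at `−x`
is minus the one at `x`, for even `f` it is the same. -/

section Symmetry

/-- `−y` is an integer iff `y` is. [cite: BrisebarreEtAl2025, Definition 2.4] -/
theorem isExactCaseDir_neg_iff (y : ℝ) : IsExactCaseDir (-y) ↔ IsExactCaseDir y := by
  constructor
  · rintro ⟨k, hk⟩; exact ⟨-k, by push_cast; linarith⟩
  · rintro ⟨k, hk⟩; exact ⟨-k, by push_cast; linarith⟩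

/-- `−y` is a half-integer iff `y` is (`−(k + ½) = (−k − 1) + ½`). [cite: BrisebarreEtAl2025, Definition 2.4] -/
theorem isExactCaseRN_neg_iff (y : ℝ) : IsExactCaseRN (-y) ↔ IsExactCaseRN y := by
  constructor
  · rintro ⟨k, hk⟩; exact ⟨-k - 1, by push_cast; linarith⟩
  · rintro ⟨k, hk⟩; exact ⟨-k - 1, by push_cast; linarith⟩

/-- `−y` is an `m`-bad case for the directed roundings iff `y` is. [cite: BrisebarreEtAl2025, §4.4] -/
theorem isBadCaseDir_neg_iff (m : ℕ) (y : ℝ) : IsBadCaseDir m (-y) ↔ IsBadCaseDir m y := by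
  constructor
  · rintro ⟨k, hk⟩
    refine ⟨-k, ?_⟩
    rw [show y - ((-k : ℤ) : ℝ) = -(-y - k) by push_cast; ring, abs_neg]; exact hk
  · rintro ⟨k, hk⟩
    refine ⟨-k, ?_⟩
    rw [show -y - ((-k : ℤ) : ℝ) = -(y - k) by push_cast; ring, abs_neg]; exact hk

/-- `−y` is an `m`-bad case for round-to-nearest iff `y` is. [cite: BrisebarreEtAl2025, §4.4] -/
theorem isBadCaseRN_neg_iff (m : ℕ) (y : ℝ) : IsBadCaseRN m (-y) ↔ IsBadCaseRN m y := by
  constructor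
  · rintro ⟨k, hk⟩
    refine ⟨-k - 1, ?_⟩
    rw [show y - (((-k - 1 : ℤ) : ℝ) + 1 / 2) = -(-y - (k + 1 / 2)) by push_cast; ring, abs_neg]
    exact hk
  · rintro ⟨k, hk⟩
    refine ⟨-k - 1, ?_⟩
    rw [show -y - (((-k - 1 : ℤ) : ℝ) + 1 / 2) = -(y - (k + 1 / 2)) by push_cast; ring, abs_neg]
    exact hk

/-- For an ODD function the scaled value at the significand `−X` (the argument `−x`) is minus the scaled value
at `X`. [cite: BrisebarreEtAl2025, Problem 4.1] -/
theorem scaled_neg_of_odd {f : ℝ → ℝ} (hf : ∀ x, f (-x) = -f x) (p : ℕ) (e₁ e₂ X : ℤ) :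
    scaled f p e₁ e₂ (-X) = -scaled f p e₁ e₂ X := by
  simp only [scaled, Int.cast_neg, neg_mul, hf, mul_neg]

/-- For an EVEN function the scaled value at `−X` equals the one at `X`. [cite: BrisebarreEtAl2025, Problem 4.1] -/
theorem scaled_neg_of_even {f : ℝ → ℝ} (hf : ∀ x, f (-x) = f x) (p : ℕ) (e₁ e₂ X : ℤ) :
    scaled f p e₁ e₂ (-X) = scaled f p e₁ e₂ X := by
  simp only [scaled, Int.cast_neg, neg_mul, hf]

/-- Hence for an odd function, `−X` is an `m`-bad case (directed) iff `X` is … [cite: BrisebarreEtAl2025, §4.4] -/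
theorem isBadCaseDir_scaled_neg_iff_of_odd {f : ℝ → ℝ} (hf : ∀ x, f (-x) = -f x) (m p : ℕ)
    (e₁ e₂ X : ℤ) : IsBadCaseDir m (scaled f p e₁ e₂ (-X)) ↔ IsBadCaseDir m (scaled f p e₁ e₂ X) := by
  rw [scaled_neg_of_odd hf, isBadCaseDir_neg_iff]

/-- … and likewise for round-to-nearest. [cite: BrisebarreEtAl2025, §4.4] -/
theorem isBadCaseRN_scaled_neg_iff_of_odd {f : ℝ → ℝ} (hf : ∀ x, f (-x) = -f x) (m p : ℕ)
    (e₁ e₂ X : ℤ) : IsBadCaseRN m (scaled f p e₁ e₂ (-X)) ↔ IsBadCaseRN m (scaled f p e₁ e₂ X) := by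
  rw [scaled_neg_of_odd hf, isBadCaseRN_neg_iff]

end Symmetry

section InverseFunction

/-- **Lemma 4.8** [cite: BrisebarreEtAl2025, Lemma 4.8]: "Let `f : I ⊂ ℝ → ℝ` be a continuously
differentiable function. Assume that for all `α ∈ [a, b] ⊂ I`, `β`, `|f(α) − β| ⩾ ε`. Then, for all
`α ∈ [a, b]`, `β ∈ f(I)`, we have `|f⁻¹(β) − α| ⩾ ε / sup_{[α, f⁻¹(β)]} |f′|`" — "a direct consequence of the
mean value Theorem". Stated for one pair: `γ` plays `f⁻¹(β)` (so `β = f γ`), `M > 0` bounds `|f′|` on the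
segment between `α` and `γ`, and `ε ⩽ |f(α) − f(γ)|` gives `ε / M ⩽ |γ − α|`. (Use: bad cases of `ln`, `atan`
from those of `exp`, `tan` — the survey's Table 4 from Table 3.) -/
theorem lemma48 {f f' : ℝ → ℝ} {α γ M ε : ℝ} (hM : 0 < M)
    (hf : ∀ x ∈ Set.uIcc α γ, HasDerivWithinAt f (f' x) (Set.uIcc α γ) x)
    (hbound : ∀ x ∈ Set.uIcc α γ, |f' x| ≤ M) (hε : ε ≤ |f α - f γ|) : ε / M ≤ |γ - α| := by
  have hmvt : ‖f γ - f α‖ ≤ M * ‖γ - α‖ :=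
    (convex_uIcc α γ).norm_image_sub_le_of_norm_hasDerivWithin_le hf
      (fun x hx => by simpa [Real.norm_eq_abs] using hbound x hx) Set.left_mem_uIcc Set.right_mem_uIcc
  rw [Real.norm_eq_abs, Real.norm_eq_abs, abs_sub_comm] at hmvt
  rw [div_le_iff₀ hM]
  linarith [mul_comm M |γ - α|]

/-- Lemma 4.8 in the bad-case vocabulary: if the value `f(α)` at a point `α` is at distance `⩾ ε` from `β = f(γ)`
and `|f′| ⩽ M` between `α` and `γ`, then `γ` (an argument of `f`, i.e. a value of `f⁻¹`) is at distance
`⩾ ε/M` from `α`; with `α` a breakpoint of the target format of `f⁻¹` and `γ = f⁻¹(β)` for a floating-point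
`β`, this converts a hardness-to-round bound for `f` at breakpoints into one for `f⁻¹` at floating-point
arguments. [cite: BrisebarreEtAl2025, Lemma 4.8 and §4.3.1] -/
theorem lemma48' {f f' : ℝ → ℝ} {α γ M ε : ℝ} (hM : 0 < M)
    (hf : ∀ x ∈ Set.uIcc α γ, HasDerivWithinAt f (f' x) (Set.uIcc α γ) x)
    (hbound : ∀ x ∈ Set.uIcc α γ, |f' x| ≤ M) (hγ : |γ - α| < ε / M) : |f α - f γ| < ε := by
  by_contra h
  exact absurd (lemma48 hM hf hbound (not_lt.1 h)) (not_le.2 hγ)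

end InverseFunction

end Literature.ComputerArithmetic.BrisebarreHanrotMullerZimmermann2025
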